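import Literature.AlgebraicGeometry.AbelianSchemes.RigidifiedGluing
import Literature.AlgebraicGeometry.AbelianSchemes.AbelianSchemeSteinOfNoetherian
import HarnessLib

/-!
# A rigidified line bundle on `A_T` which is trivial on every `A_{U_i}` (`U_i` an open cover of `T`) is trivial

Layer `Literature/AlgebraicGeometry/AbelianSchemes`, namespace `Literature.AlgebraicGeometry.AbelianSchemes`
(dot notation on `AbelianSchemeOver` / `AbelianSchemeOver.RigidifiedLineBundle`).  THEOREMS ONLY; no definition, no
named fact, no instance, no notation, no `sorry`.

Setting of ★ `AbelianSchemes/RigidifiedGluing`: an abelian scheme `A / S`, a test scheme `f : T → S` with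
`π : A_T → T` «Stein» (`π^♯` bijective on EVERY open `W ⊆ T`; for `S` locally Noetherian this holds for every `T`, ★
`AbelianSchemeOver.baseChange_app_bijective` of `AbelianSchemes/AbelianSchemeSteinOfNoetherian`), an open cover `U_i` of `T`
(Mathlib `Scheme.OpenCover`, members `𝒰.f i : U_i → T`) and the morphisms `1_A × uᵢ : A_{U_i} → A_T` (★ `prodMap`).

* §1 **`cechPic_eq_one_of_cover_of_unitSection_of_steinAt`** — the class-level key of ★ `RigidifiedGluing`
  («a Čech class on `A_T` dying on every `A_{U_i}` and along the zero section `ε_T` is `1`») with the Stein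
  hypothesis AT `T` ONLY (the ★ statement `cechPic_eq_one_of_cover_of_unitSection` quantifies it over all test
  schemes but uses it at `f` alone; same proof: the class is trivialised on the saturated cover `π⁻¹(U_i)`, hence
  presented along `π`, hence killed by the identity section).
* §2 **`RigidifiedLineBundle.nonempty_iso_of_openCover`** — TWO rigidified line bundles `M₁`, `M₂` on `A_T` with
  `(1_A × uᵢ)^* M₁ ≅ (1_A × uᵢ)^* M₂` for all `i` are isomorphic: by ★ `nonempty_iso_iff_detClass_eq` it is enough
  that `[det M₁]·[det M₂]⁻¹ = 1` in `Ȟ¹(A_T, 𝒪^×)`, and that class dies on every `A_{U_i}` (★ `detClass_pullback`, ★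
  `detClass_eq_of_iso`) and along `ε_T` (both rigidifications, ★ `detClass_unitModule_eq_one`) — §1.
  `comapAlong` spelling: `RigidifiedLineBundle.nonempty_iso_of_comapAlong_iso`.
* §3 **`RigidifiedLineBundle.nonempty_iso_unit_of_openCover`** — ONE rigidified line bundle `N` on `A_T` with
  `(1_A × uᵢ)^* N ≅ 𝒪` for all `i` is trivial, `N ≅ 𝒪` (same argument against `𝒪`, ★ `hasRank_unitModule`);
  `comapAlong` spelling: `RigidifiedLineBundle.nonempty_iso_unit_of_comapAlong_iso_unit`; iff form
  `RigidifiedLineBundle.nonempty_iso_unit_iff_openCover` (triviality of a rigidified line bundle is local on `T`).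
* §4 `S` locally Noetherian: the Stein hypothesis DISCHARGED by ★ `AbelianSchemeOver.baseChange_app_bijective` —
  **`RigidifiedLineBundle.nonempty_iso_of_openCover_of_isLocallyNoetherian`**,
  **`RigidifiedLineBundle.nonempty_iso_unit_of_openCover_of_isLocallyNoetherian`** (no hypothesis beyond the cover).

This is the Zariski companion «(u6b-Z)» of the fpqc descent of rigidified trivialisations in cell `hodgecm-mathlib`
(socket (B), D6 universal property of the descended Poincaré sheaf): normalised local trivialisations of a rigidified
line bundle differ on overlaps by units `u` on `A_{U_ij}` with `ε^* u = 1`, which come from `U_ij` by Stein and hence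
are `1`, so they glue — here run through the Čech Picard group.  [MumfordAV1970] §13 (proof of the Thm. p. 125) with
§5 Cor. 6 (p. 54); [MilneAV2008] I §8 (pp. 36–37: dual pair, universal property (a′)(b′), Rem. 8.7); [GortzWedhorn2023] Lemma 24.67, Thm. 24.66.  No flatness or
quasi-compactness hypothesis.

HC_CM is proved only modulo the 7 printed citations until rung 0 closes; nothing here is about HC.

## References
* [MumfordAV1970] D. Mumford, *Abelian Varieties* (1970), §13 (proof of the Thm. p. 125), §5 Cor. 6 (p. 54).
* [MilneAV2008] J. S. Milne, *Abelian Varieties* (v2.00, 2008), I §8 (pp. 36–37: the dual pair `(A^∨, 𝒫)`, universal property (a′)(b′), Rem. 8.7).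
* [GortzWedhorn2023] U. Görtz, T. Wedhorn, *Algebraic Geometry II: Cohomology of Schemes* (2023), Thm. 24.66, Lemma 24.67 (p. 406).
* [Hartshorne1977] R. Hartshorne, *Algebraic Geometry*, GTM 52 (1977), II Ex. 6.8, III Ex. 4.5.
-/

universe u

open CategoryTheory CategoryTheory.Limits AlgebraicGeometry MonoidalCategory

noncomputable section

-- `Scheme.Modules` / `SheafOfModules` are not reducible (as in Mathlib's `AlgebraicGeometry/Modules/Sheaf.lean`).
set_option backward.isDefEq.respectTransparency false

namespace Literature.AlgebraicGeometry.AbelianSchemes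

open Literature.AlgebraicGeometry.Motives Literature.AlgebraicGeometry.AbelianVarieties
  Literature.AlgebraicGeometry.Modules

namespace AbelianSchemeOver

variable {S : Scheme.{u}} (A : AbelianSchemeOver S)

/-! ### §1 The class-level key with the Stein hypothesis at `T` only -/

section Key

/-- **The class-level key, Stein at `T` only**: for `f : T → S` with `π^♯ : Γ(W, 𝒪_T) → Γ(π⁻¹W, 𝒪_{A_T})` bijective
for every open `W ⊆ T`, a Čech class on `A_T` which is trivial on every `A_{U_i}` (`U_i` an open cover of `T`) and
along the zero section `ε_T` is trivial (the ★ `cechPic_eq_one_of_cover_of_unitSection` argument verbatim: trivialised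
on the saturated cover `π⁻¹(U_i)` — `UnitCocycle.trivOnOfPullbackEqOne`, `cechPic_pullback_fst_eq_one` —, presented
along `π` — `CechPic.mk_eq_mk_presented_of_trivOn` —, killed by the identity section —
`CechPic.mk_presented_eq_one_of_section`).
[cite: MumfordAV1970, §13 (proof of the Thm. p. 125) with §5 Cor. 6 (p. 54)] [cite: GortzWedhorn2023, Lemma 24.67, Thm. 24.66] -/
theorem cechPic_eq_one_of_cover_of_unitSection_of_steinAt {T : Scheme.{u}} (f : T ⟶ S)
    (hSt : ∀ W : T.Opens, Function.Bijective ((A.baseChange f).X.hom.app W))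
    (𝒰 : Scheme.OpenCover.{u} T) (c : CechPic (A.baseChange f).X.left)
    (hloc : ∀ i, CechPic.pullback (A.prodMap (𝒰.f i ≫ f) f (𝒰.f i) rfl) c = 1)
    (hε : CechPic.pullback (A.baseChange f).unitSection c = 1) : c = 1 := by
  obtain ⟨γ, rfl⟩ := CechPic.mk_surjective c
  -- trivialisations over the members `π⁻¹(U_i)` of the saturated cover
  have t : ∀ i, γ.TrivOn ((A.baseChange f).X.hom ⁻¹ᵁ (𝒰.f i).opensRange) := fun i =>
    (UnitCocycle.trivOnOfPullbackEqOne (ρ := pullback.fst (A.baseChange f).X.hom (𝒰.f i)) γ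
      (A.cechPic_pullback_fst_eq_one f (𝒰.f i) _ (hloc i))).ofEq γ (Scheme.Hom.opensRange_pullbackFst _ _)
  -- presented along `π`
  obtain ⟨G, hmul, hunit, gX, hUX, hgX, hγ⟩ :=
    CechPic.mk_eq_mk_presented_of_trivOn (A.baseChange f).X.hom hSt (fun i => (𝒰.f i).opensRange) 𝒰.idx
      (fun x => 𝒰.covers x) γ t
  rw [hγ] at hε ⊢
  -- and killed by the identity section
  exact CechPic.mk_presented_eq_one_of_section (π := (A.baseChange f).X.hom) (idx := 𝒰.idx)
    (A := fun i => (𝒰.f i).opensRange) (G := G) (A.baseChange f).unitSection (A.baseChange f).unitSection_comp_hom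
    (fun x => 𝒰.covers x) hmul hunit hUX hgX hε

end Key

/-! ### §2 Two rigidified line bundles isomorphic on every `A_{U_i}` are isomorphic -/

namespace RigidifiedLineBundle

variable {A} {T : Scheme.{u}} {f : T ⟶ S}

/-- The determinant class of a rigidified line bundle dies along the zero section `ε_T` (the rigidification
`ε_T^* M ≅ 𝒪_T` and `[𝒪] = 1`, ★ `detClass_pullback` / `detClass_eq_of_iso` / `detClass_unitModule_eq_one`).
[cite: MumfordAV1970, §5 Cor. 6 (p. 54)] [cite: Hartshorne1977, III Ex. 4.5] -/
theorem cechPic_pullback_unitSection_detClass (M : A.RigidifiedLineBundle f) (hM : IsFiniteLocallyFree M.L) :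
    CechPic.pullback (A.baseChange f).unitSection (detClass hM) = 1 := by
  obtain ⟨r⟩ := M.rigid
  rw [← detClass_pullback]
  exact (detClass_eq_of_iso r _ (HasRank.isFiniteLocallyFree' hasRank_unitModule)).trans
    (detClass_unitModule_eq_one _)

/-- **Two rigidified line bundles on `A_T` which become isomorphic on every `A_{U_i}` (`U_i` an open cover of `T`,
`A_T → T` Stein) are isomorphic**: `[det M₁]·[det M₂]⁻¹ ∈ Ȟ¹(A_T, 𝒪^×)` dies on every `A_{U_i}` (the local
isomorphisms) and along `ε_T` (the two rigidifications), hence is `1` by §1, and rank-one modules with equal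
determinant classes are isomorphic (★ `nonempty_iso_iff_detClass_eq`).  The isomorphisms on the `A_{U_i}` need not be
compatible or normalised. [cite: MumfordAV1970, §13 (proof of the Thm. p. 125) with §5 Cor. 6 (p. 54)]
[cite: MilneAV2008, I §8 (pp. 36–37: dual pair, universal property (a′)(b′), Rem. 8.7)] [cite: GortzWedhorn2023, Lemma 24.67] -/
theorem nonempty_iso_of_openCover (M₁ M₂ : A.RigidifiedLineBundle f)
    (hSt : ∀ W : T.Opens, Function.Bijective ((A.baseChange f).X.hom.app W)) (𝒰 : Scheme.OpenCover.{u} T)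
    (h : ∀ i, Nonempty ((Scheme.Modules.pullback (A.prodMap (𝒰.f i ≫ f) f (𝒰.f i) rfl)).obj M₁.L ≅
      (Scheme.Modules.pullback (A.prodMap (𝒰.f i ≫ f) f (𝒰.f i) rfl)).obj M₂.L)) :
    Nonempty (M₁.L ≅ M₂.L) := by
  have h₁ : HasRank M₁.L 1 := M₁.hasRank_one
  have h₂ : HasRank M₂.L 1 := M₂.hasRank_one
  have h₁f := HasRank.isFiniteLocallyFree' h₁
  have h₂f := HasRank.isFiniteLocallyFree' h₂
  refine (nonempty_iso_iff_detClass_eq h₁ h₂ h₁f h₂f).2 ?_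
  suffices hc : detClass h₁f * (detClass h₂f)⁻¹ = 1 from mul_inv_eq_one.mp hc
  apply A.cechPic_eq_one_of_cover_of_unitSection_of_steinAt f hSt 𝒰
  · intro i
    obtain ⟨φ⟩ := h i
    have e := detClass_eq_of_iso φ (h₁f.pullback (A.prodMap (𝒰.f i ≫ f) f (𝒰.f i) rfl))
      (h₂f.pullback (A.prodMap (𝒰.f i ≫ f) f (𝒰.f i) rfl))
    rw [map_mul, map_inv, ← detClass_pullback, ← detClass_pullback, e, mul_inv_cancel]
  · rw [map_mul, map_inv, M₁.cechPic_pullback_unitSection_detClass h₁f, M₂.cechPic_pullback_unitSection_detClass h₂f,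
      inv_one, mul_one]

/-- `comapAlong` spelling of `nonempty_iso_of_openCover`: if the restrictions `M₁|_{U_i}`, `M₂|_{U_i}` (★
`RigidifiedLineBundle.comapAlong (𝒰.f i)`, module `(1_A × uᵢ)^* Mₖ` by ★ `comapAlong_L`) have isomorphic modules for
every member of an open cover, then `M₁ ≅ M₂`. [cite: MumfordAV1970, §13 (proof of the Thm. p. 125)]
[cite: MilneAV2008, I §8 (pp. 36–37: dual pair, universal property (a′)(b′), Rem. 8.7)] -/
theorem nonempty_iso_of_comapAlong_iso (M₁ M₂ : A.RigidifiedLineBundle f)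
    (hSt : ∀ W : T.Opens, Function.Bijective ((A.baseChange f).X.hom.app W)) (𝒰 : Scheme.OpenCover.{u} T)
    (h : ∀ i, Nonempty ((M₁.comapAlong (𝒰.f i) rfl).L ≅ (M₂.comapAlong (𝒰.f i) rfl).L)) :
    Nonempty (M₁.L ≅ M₂.L) :=
  nonempty_iso_of_openCover M₁ M₂ hSt 𝒰 h

end RigidifiedLineBundle

/-! ### §3 A rigidified line bundle trivial on every `A_{U_i}` is trivial -/

namespace RigidifiedLineBundle

variable {A} {T : Scheme.{u}} {f : T ⟶ S}

/-- **A rigidified line bundle on `A_T` which is trivial on every `A_{U_i}` (`U_i` an open cover of `T`, `A_T → T`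
Stein on all opens of `T`) is trivial**: `[det N] ∈ Ȟ¹(A_T, 𝒪^×)` dies on every `A_{U_i}` (the local trivialisations,
★ `detClass_pullback`, `detClass_unitModule_eq_one`) and along `ε_T` (the rigidification), hence is `1` (§1), and a
rank-one module with trivial determinant class is `≅ 𝒪` (★ `nonempty_iso_iff_detClass_eq`, ★ `hasRank_unitModule`).
The local trivialisations need not be normalised or compatible; no flatness or quasi-compactness is used.
[cite: MumfordAV1970, §13 (proof of the Thm. p. 125) with §5 Cor. 6 (p. 54)] [cite: MilneAV2008, I §8 (pp. 36–37: dual pair, universal property (a′)(b′), Rem. 8.7)]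
[cite: GortzWedhorn2023, Lemma 24.67, Thm. 24.66] -/
theorem nonempty_iso_unit_of_openCover (N : A.RigidifiedLineBundle f)
    (hSt : ∀ W : T.Opens, Function.Bijective ((A.baseChange f).X.hom.app W)) (𝒰 : Scheme.OpenCover.{u} T)
    (h : ∀ i, Nonempty ((Scheme.Modules.pullback (A.prodMap (𝒰.f i ≫ f) f (𝒰.f i) rfl)).obj N.L ≅
      SheafOfModules.unit _)) :
    Nonempty (N.L ≅ SheafOfModules.unit _) := by
  have hN : HasRank N.L 1 := N.hasRank_one
  have hNf := HasRank.isFiniteLocallyFree' hN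
  have hUf := HasRank.isFiniteLocallyFree' (hasRank_unitModule (X := (A.baseChange f).X.left))
  refine (nonempty_iso_iff_detClass_eq hN hasRank_unitModule hNf hUf).2 ?_
  rw [detClass_unitModule_eq_one]
  apply A.cechPic_eq_one_of_cover_of_unitSection_of_steinAt f hSt 𝒰
  · intro i
    obtain ⟨φ⟩ := h i
    rw [← detClass_pullback]
    exact (detClass_eq_of_iso φ (hNf.pullback (A.prodMap (𝒰.f i ≫ f) f (𝒰.f i) rfl))
      (HasRank.isFiniteLocallyFree' hasRank_unitModule)).trans (detClass_unitModule_eq_one _)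
  · exact N.cechPic_pullback_unitSection_detClass hNf

/-- `comapAlong` spelling of `nonempty_iso_unit_of_openCover`: if every restriction `N|_{U_i}` (★
`RigidifiedLineBundle.comapAlong (𝒰.f i)`) has trivial module, then `N ≅ 𝒪`. [cite: MumfordAV1970, §13 (proof of the Thm. p. 125)]
[cite: MilneAV2008, I §8 (pp. 36–37: dual pair, universal property (a′)(b′), Rem. 8.7)] -/
theorem nonempty_iso_unit_of_comapAlong_iso_unit (N : A.RigidifiedLineBundle f)
    (hSt : ∀ W : T.Opens, Function.Bijective ((A.baseChange f).X.hom.app W)) (𝒰 : Scheme.OpenCover.{u} T)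
    (h : ∀ i, Nonempty ((N.comapAlong (𝒰.f i) rfl).L ≅ SheafOfModules.unit _)) :
    Nonempty (N.L ≅ SheafOfModules.unit _) :=
  nonempty_iso_unit_of_openCover N hSt 𝒰 h

/-- **Triviality of a rigidified line bundle on `A_T` is LOCAL on `T`** (iff form of
`nonempty_iso_unit_of_openCover`; the easy direction is the pull-back of a trivialisation, ★
`RigidifiedLineBundle.pullbackUnitIso`). [cite: MumfordAV1970, §13 (proof of the Thm. p. 125)] [cite: GortzWedhorn2023, Lemma 24.67] -/
theorem nonempty_iso_unit_iff_openCover (N : A.RigidifiedLineBundle f)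
    (hSt : ∀ W : T.Opens, Function.Bijective ((A.baseChange f).X.hom.app W)) (𝒰 : Scheme.OpenCover.{u} T) :
    Nonempty (N.L ≅ SheafOfModules.unit _) ↔
      ∀ i, Nonempty ((Scheme.Modules.pullback (A.prodMap (𝒰.f i ≫ f) f (𝒰.f i) rfl)).obj N.L ≅
        SheafOfModules.unit _) :=
  ⟨fun ⟨e⟩ _ => ⟨(Scheme.Modules.pullback _).mapIso e ≪≫ pullbackUnitIso _⟩,
    fun h => nonempty_iso_unit_of_openCover N hSt 𝒰 h⟩

end RigidifiedLineBundle

/-! ### §4 `S` locally Noetherian: the Stein hypothesis discharged -/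

namespace RigidifiedLineBundle

variable {A} {T : Scheme.{u}} {f : T ⟶ S}

/-- **Two rigidified line bundles on `A_T` isomorphic on every `A_{U_i}` are isomorphic, `S` locally Noetherian**
(`nonempty_iso_of_openCover` with `A_T → T` Stein on all opens by ★ `AbelianSchemeOver.baseChange_app_bijective`).
[cite: MumfordAV1970, §13 (proof of the Thm. p. 125) with §5 Cor. 6 (p. 54)] [cite: GortzWedhorn2023, Cor. 24.63 (p. 404), Lemma 24.67] -/
theorem nonempty_iso_of_openCover_of_isLocallyNoetherian [IsLocallyNoetherian S] (M₁ M₂ : A.RigidifiedLineBundle f)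
    (𝒰 : Scheme.OpenCover.{u} T)
    (h : ∀ i, Nonempty ((Scheme.Modules.pullback (A.prodMap (𝒰.f i ≫ f) f (𝒰.f i) rfl)).obj M₁.L ≅
      (Scheme.Modules.pullback (A.prodMap (𝒰.f i ≫ f) f (𝒰.f i) rfl)).obj M₂.L)) :
    Nonempty (M₁.L ≅ M₂.L) :=
  nonempty_iso_of_openCover M₁ M₂ (fun W => A.baseChange_app_bijective f W) 𝒰 h

/-- **A rigidified line bundle on `A_T` trivial on every `A_{U_i}` is trivial, `S` locally Noetherian**
(`nonempty_iso_unit_of_openCover` with `A_T → T` Stein on all opens by ★ `AbelianSchemeOver.baseChange_app_bijective`).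
[cite: MumfordAV1970, §13 (proof of the Thm. p. 125) with §5 Cor. 6 (p. 54)] [cite: GortzWedhorn2023, Cor. 24.63 (p. 404), Lemma 24.67] -/
theorem nonempty_iso_unit_of_openCover_of_isLocallyNoetherian [IsLocallyNoetherian S] (N : A.RigidifiedLineBundle f)
    (𝒰 : Scheme.OpenCover.{u} T)
    (h : ∀ i, Nonempty ((Scheme.Modules.pullback (A.prodMap (𝒰.f i ≫ f) f (𝒰.f i) rfl)).obj N.L ≅
      SheafOfModules.unit _)) :
    Nonempty (N.L ≅ SheafOfModules.unit _) :=
  nonempty_iso_unit_of_openCover N (fun W => A.baseChange_app_bijective f W) 𝒰 h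

end RigidifiedLineBundle

end AbelianSchemeOver

end Literature.AlgebraicGeometry.AbelianSchemes

end
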